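import Summits.QuantumFields.YangMills.Theorems.FluctuationComparisonRegPrIntLSupTailCoverUnionEventual
import Summits.QuantumFields.YangMills.Theorems.FluctuationComparisonRegPrIntLSupTailCoverUnionFibreTail
import HarnessLib

/-!
# `FluctuationComparisonRegPrIntLSupTailCoverUnionPrintedForm` — THE PRINTED-FORM DOORS: TAILSUP₁∘ `WindowOddsSupDepthOneIntCan` verbatim from per-plaquette inputs in PRINT'S
# CURRENCY `C·β^A·e^{−c·p(g)²}`, a LINEAR far moment and the per-level floor — every bookkeeping letter (`s, J₀, σm, M`) of ✓N ∕ ✓O ∕ ✓P discharged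
# (crux `UnitScaleTilt.FluctuationComparisonRegPrIntL`, stmt-QuantumFields-20520; companion of `…SupTailCoverUnionEventual` (§1 arithmetic, §2 eventual edition of ✓N §4),
# ✓O `…SupTailCoverUnionTwoRegime`, ✓P `…SupTailCoverUnionFibreTail`, ✓K `…SupTailReductionInt`)

Cell `ym3-torus` (YM ladder rung R3 = continuum SU(2) Yang–Mills on T³ — a RUNG, NOT the Clay problem: not d = 4, not infinite volume, not a mass gap);
width seat `ym3-torus-px20` (gen 11); helper `--supports stmt-QuantumFields-20520`.  THEOREMS ONLY (0 `def`, 0 `sorry`, default heartbeats).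

WHAT.  ✓O ∕ ✓P ask the hand, besides per-plaquette estimates, for functions `s, σm, M` and a threshold `J₀` with `Σ_p σm J p + #T_{J+1}·e^{−β_{J+1}δ₀²∕4}·e^{M J} ≤ s J`, `s`
super-polynomially small and `≤ ½` for `J ≥ J₀`.  Once the per-plaquette inputs are in print's currency `C·β_{J+1}^A·e^{−c·p(g_{J+1})²}` ([Balaban1985UV3] (71) p. 273; the tree's
schema of lit `T3AveragedTailProfile.perHeight_bound`) and the far moment is linear, `M J = cM·β_{J+1}` with `cM < δ₀²∕4`, those letters are ARITHMETIC (companion §1: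
`s J = A'·(1∕2)^{J+1}`, `J₀ = J₀(F.m, L, γ, b₀, C, A, c, δ₀, cM)` — the only place `F.m` enters):
* ★★★`condGoodOddsDepthOneInt_of_pinnedPrinted_floor` ∕ ★★★`windowOddsSupDepthOneInt_of_pinnedPrinted_floor` — ONE regime, total-mass currency: rows
  `Gibbs_{J+1}(D⁻¹B ∩ {θBal_{J+1} ≤ dist1 U(∂p)}) ≤ ofReal(C·β_{J+1}^A·e^{−c·p(g_{J+1})²})·Gibbs_{J+1}(D⁻¹B)` + FLOOR at every `J` ⇒ ✓K's ⟨COND-ODDS₁∘⟩ ∕ TAILSUP₁∘ (companion §2 ∘ §1).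
* ★★★`condGoodOddsDepthOneInt_of_fibreTailPrinted_linearMoment_floor` ∕ ★★★`windowOddsSupDepthOneInt_of_fibreTailPrinted_linearMoment_floor` — TWO regimes, fibrewise: (TAIL)
  `∫⁻_{θBal_{J+1} ≤ dist1 < δ₀} boltzmann dκ_V ≤ ofReal(C·β_{J+1}^A·e^{−c·p(g_{J+1})²})·∫⁻ boltzmann dκ_V`, (MOMENT-LIN) `⨍ β_{J+1}(1−reTr U(∂p)) d(κ_V.withDensity e^{−β_{J+1}A_{¬p}}) ≤ cM·β_{J+1}`,
  `cM < δ₀²∕4`, + FLOOR at every `J` ⇒ ⟨COND-ODDS₁∘⟩ ∕ TAILSUP₁∘ (✓P §2 ∘ companion §1).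
DOCKING.  The one-regime door's (ROWS) conjunct is the DEPTH-ONE instance (`j = K = J+1`) of LINE g22-3's row PLAQTAIL∘ `stub_plaquetteGaussTailIntCan`
(`Cruxes/…/Lines/plaquette_tail.lean`: `∃ κ A, 0 < κ ∧ … Gibbs_K(D_J⁻¹B ∩ {θBal_j ≤ dist1 …}) ≤ ofReal(A·e^{−κ·(pFun b₀ p₀ √(γL^{−j}))²})·Gibbs_K(D_J⁻¹B)`) in the letters
`C := A`, exponent `A := 0`, `cT := κ` (no sign condition on the prefactor, as there); with `δ₀ ≥ 3 > 2 ≥ dist1` the far regime is empty, so the two-regime door earns its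
keep only for a (TAIL) hand confined to a chart radius `δ₀ ≤ 2` (LEAD w3-20520 g18, 2026-08-30T05:44Z).
SO AFTER THIS FILE THE HAND'S RESIDUE FOR TAILSUP₁∘ IS EXACTLY: (TAIL) the per-plaquette moderate window-exit fraction of the Boltzmann-tilted conditional Haar law one level deep,
in print's currency (chart + convexity); (MOMENT-LIN) a linear first moment of the deleted plaquette's tilted action (equipartition); the per-level FLOOR.  No profile, threshold,
weight or moment FUNCTION is left to supply.
HONEST SCOPE.  Bookkeeping (union bound ∕ entropy ∕ eventuality); (ROWS)∕(TAIL), (MOMENT-LIN) and the floor are the HYPOTHESIS and are NOT proved; TAILSUP₁∘, MOD₁∘, FAR₁, LFR♯ᶜ∘,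
S2β, 20520, `YM3TorusSU2` NOT proved; the Yang–Mills mass gap is NOT proved.
HYP-SAT (cell RULING №42).  Every letter of the hypotheses (`C, A, c, δ₀, cM`, the floor `q`; `C` of any sign) is bound AFTER `F, γ`, so the hypotheses are satisfiable on the literal T³
families at the true quantifier order modulo their analytic contents: (ROWS)∕(TAIL) = [Balaban1985UV3] (38)–(40) p. 266 ∕ (71) p. 273 per plaquette (chart + convexity one
level deep — no hand yet); (MOMENT-LIN) = equipartition (`O(1) ≤ cM·β_{J+1}` — no hand yet; NOTE the trivial bound `1 − reTr ≤ 2` gives `cM = 2`, admissible iff `δ₀² > 8`,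
where the far event `{δ₀ ≤ dist1}` is EMPTY on `SU(2)` — the letter has content exactly when the (TAIL) hand needs `δ₀ ≤ 2`); the FLOOR at every `J` = the per-`J`
positivity row FLOOR₁∘(J) (cst-p1 g35's pen; px21 g13 located its one `L^∞` letter; the door uses it only below its own `J₀`).  The smallness is EVENTUAL by construction
(`J₀` after `F.m`); `p₀ ≥ 1` and `γ ≤ 1` are arranged inside (`pS ↦ max pS 1`, `γ₁ ↦ min γ₁ 1`).
References: [Balaban1985UV3] (2) p. 256, (7) p. 257, (38)–(40) p. 266, (67)–(71) p. 273; [Balaban1985Averaging] (10) p. 19.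
-/

noncomputable section

set_option autoImplicit false

open MeasureTheory ProbabilityTheory Filter Topology Set
open scoped ENNReal NNReal BigOperators
open Literature.MathematicalPhysics.QuantumFieldTheory.Balaban1983to89
open Literature.MathematicalPhysics.QuantumFieldTheory.Balaban1983to89.T3ContinuumYM3Torus
open Literature.MathematicalPhysics.QuantumFieldTheory.Balaban1983to89.T3NestedUnitLaws
open Literature.MathematicalPhysics.QuantumFieldTheory.Balaban1983to89.T3UnitLawDensityEML
open Literature.MathematicalPhysics.QuantumFieldTheory.Balaban1983to89.T3UnitScaleTilt
open Literature.MathematicalPhysics.QuantumFieldTheory.Balaban1983to89.T3TiltDescent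
open Literature.MathematicalPhysics.QuantumFieldTheory.Balaban1983to89.Missing
open Literature.MathematicalPhysics.QuantumFieldTheory.Balaban1983to89.T4AveragingDisintegration
open scoped Literature.MathematicalPhysics.QuantumFieldTheory.Balaban1983to89.T3OrbitAverage
open Summit.QuantumFields.YangMills.Theorems.FluctuationComparisonRegPrIntLWregGlue (heightDensityCan)
open Summit.QuantumFields.YangMills.Theorems.FluctuationComparisonRegPrIntLSupTailCoverUnionFibreTail (condGoodOddsDepthOneInt_of_fibreTail_farMoment)
open Summit.QuantumFields.YangMills.Theorems.FluctuationComparisonRegPrIntLSupTailCoverUnionEventual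

namespace Summit.QuantumFields.YangMills.Theorems.FluctuationComparisonRegPrIntLSupTailCoverUnionPrintedForm

/-! ## The printed-form doors: per-plaquette inputs in the currency `C·β^A·e^{−c·p(g)²}` + a linear far moment + the floor ⇒ ⟨COND-ODDS₁∘⟩ ⇒ TAILSUP₁∘ -/

section Printed

/-- ★★★ **ONE REGIME, PRINT'S CURRENCY: ⟨PINNED-PRINTED₁∘ + FLOOR⟩ ⇒ ✓K's ⟨COND-ODDS₁∘⟩.**  Hypothesis (TAILSUP₁∘'s quantifier prefix, then; all letters after `F, γ`): constants
`C`, `A : ℕ`, `c > 0` (no sign condition on `C`: `max C 0` is used inside); (FLOOR) at EVERY level `J` a floor `q > 0` with `ofReal(q)·Gibbs_{J+1}(D⁻¹B) ≤ Gibbs_{J+1}(D⁻¹B ∩ histGood)` for measurable `B` in the interior window;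
(ROWS) for every `J`, fine plaquette `p ∈ T_{J+1}` and measurable `B` in the interior window, in TOTAL-mass currency,
`Gibbs_{J+1}(D⁻¹B ∩ {θBal L γ b₀ p₀ (J+1) ≤ dist1 U(∂p)}) ≤ ofReal(C·β_{J+1}^A·e^{−c·pFun b₀ p₀ (g_{J+1})²})·Gibbs_{J+1}(D⁻¹B)`, `g_{J+1} = √(γL^{−(J+1)})` — print's per-plaquette large-field
factor.  The smallness profile `s J = A'·(1∕2)^{J+1}`, its threshold `J₀` (after `F.m`) and the weights are produced here (companion `…SupTailCoverUnionEventual` §1, lit `perHeight_bound`; `p₀ ≥ 1` and `γ ≤ 1` by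
`pS ↦ max pS 1`, `γ₁ ↦ min γ₁ 1`), then companion §2 `condGoodOddsDepthOneInt_of_pinnedTotalFineInt_eventual`. [cite: Balaban1985UV3, (2) p.256, (7) p.257, (38)-(40) p.266 and (71) p.273] -/
theorem condGoodOddsDepthOneInt_of_pinnedPrinted_floor
    (h : ∀ (L : ℕ), ∃ c₀ : ℝ, 0 < c₀ ∧ c₀ ≤ 1 ∧ ∀ (c : ℝ), 0 < c → c ≤ c₀ → ∃ pS : ℝ, ∀ (b₀ p₀ : ℝ), 0 < b₀ → pS ≤ p₀ → 0 < p₀ →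
      ∃ γ₁ : ℝ, 0 < γ₁ ∧ ∀ (F : T3Family) (γ : ℝ), F.L = L → 0 < γ → γ ≤ γ₁ →
        ∃ (C : ℝ) (A : ℕ) (cT : ℝ), 0 < cT ∧
          (∀ J : ℕ, ∃ q : ℝ, 0 < q ∧ ∀ (B : Set (GaugeField (F.P J) 0 (Matrix.specialUnitaryGroup (Fin 2) ℂ))), MeasurableSet B →
            B ⊆ {U | PlaqSmall (θBal F.L γ (c * b₀) p₀ J) U} →
            ENNReal.ofReal q * gibbsK F ℰp γ (J + 1) (descendTo F ℰp J (J + 1) (Nat.le_succ J) ⁻¹' B) ≤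
              gibbsK F ℰp γ (J + 1) (descendTo F ℰp J (J + 1) (Nat.le_succ J) ⁻¹' B ∩ histGood F ℰp (θBal F.L γ b₀ p₀) (J + 1) J)) ∧
          ∀ (J : ℕ) (p : Plaq (F.P (J + 1)) 0) (B : Set (GaugeField (F.P J) 0 (Matrix.specialUnitaryGroup (Fin 2) ℂ))), MeasurableSet B →
            B ⊆ {U | PlaqSmall (θBal F.L γ (c * b₀) p₀ J) U} →
            gibbsK F ℰp γ (J + 1) (descendTo F ℰp J (J + 1) (Nat.le_succ J) ⁻¹' B ∩
                {U | θBal F.L γ b₀ p₀ (J + 1) ≤ dist1 (GaugeField.plaqHol U p)}) ≤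
              ENNReal.ofReal (C * (F.scheme ℰp γ).β (J + 1) ^ A *
                  Real.exp (-(cT * B10.pFun b₀ p₀ (Real.sqrt (γ * ((F.L : ℝ)⁻¹) ^ (J + 1))) ^ 2))) *
                gibbsK F ℰp γ (J + 1) (descendTo F ℰp J (J + 1) (Nat.le_succ J) ⁻¹' B)) :
    ∀ (L : ℕ), ∃ c₀ : ℝ, 0 < c₀ ∧ c₀ ≤ 1 ∧ ∀ (c : ℝ), 0 < c → c ≤ c₀ → ∃ pS : ℝ, ∀ (b₀ p₀ : ℝ), 0 < b₀ → pS ≤ p₀ → 0 < p₀ →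
      ∃ γ₁ : ℝ, 0 < γ₁ ∧ ∀ (F : T3Family) (γ : ℝ), F.L = L → 0 < γ → γ ≤ γ₁ →
        ∃ τ : ℕ → ℝ, (∀ J, 0 ≤ τ J) ∧ (∀ a : ℕ, Tendsto (fun J : ℕ => ((J : ℝ) + 1) ^ a * τ J) atTop (𝓝 0)) ∧
          ∀ (J : ℕ) (B : Set (GaugeField (F.P J) 0 (Matrix.specialUnitaryGroup (Fin 2) ℂ))), MeasurableSet B →
            B ⊆ {U | PlaqSmall (θBal F.L γ (c * b₀) p₀ J) U} →
            gibbsK F ℰp γ (J + 1) (descendTo F ℰp J (J + 1) (Nat.le_succ J) ⁻¹' B) ≤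
              ENNReal.ofReal (Real.exp (τ J)) *
                gibbsK F ℰp γ (J + 1) (descendTo F ℰp J (J + 1) (Nat.le_succ J) ⁻¹' B ∩ histGood F ℰp (θBal F.L γ b₀ p₀) (J + 1) J) := by
  refine condGoodOddsDepthOneInt_of_pinnedTotalFineInt_eventual fun L => ?_
  obtain ⟨c₀, hc₀, hc₀1, hc⟩ := h L
  refine ⟨c₀, hc₀, hc₀1, fun c hcpos hcle => ?_⟩
  obtain ⟨pS, hpS⟩ := hc c hcpos hcle
  refine ⟨max pS 1, fun b₀ p₀ hb₀ hpS' hp₀ => ?_⟩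
  have hp1 : 1 ≤ p₀ := le_trans (le_max_right pS 1) hpS'
  obtain ⟨γ₁, hγ₁, hγ₁F⟩ := hpS b₀ p₀ hb₀ (le_trans (le_max_left pS 1) hpS') hp₀
  refine ⟨min γ₁ 1, lt_min hγ₁ one_pos, fun F γ hFL hγ hγle => ?_⟩
  have hγ1 : γ ≤ 1 := le_trans hγle (min_le_right γ₁ 1)
  obtain ⟨C, A, cT, hcT, hfloor, hrows⟩ := hγ₁F F γ hFL hγ (le_trans hγle (min_le_left γ₁ 1))
  choose q hq hqfloor using hfloor
  -- a non-negative prefactor `max C 0` (the rows with `C` imply the rows with `max C 0`)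
  have hC : 0 ≤ max C 0 := le_max_right C 0
  have hw : ∀ J : ℕ, C * (F.scheme ℰp γ).β (J + 1) ^ A * Real.exp (-(cT * B10.pFun b₀ p₀ (Real.sqrt (γ * ((F.L : ℝ)⁻¹) ^ (J + 1))) ^ 2)) ≤
      max C 0 * (F.scheme ℰp γ).β (J + 1) ^ A * Real.exp (-(cT * B10.pFun b₀ p₀ (Real.sqrt (γ * ((F.L : ℝ)⁻¹) ^ (J + 1))) ^ 2)) := fun J =>
    mul_le_mul_of_nonneg_right (mul_le_mul_of_nonneg_right (le_max_left C 0) (pow_nonneg (F.scheme_β_nonneg ℰp hγ.le (J + 1)) A))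
      (Real.exp_nonneg _)
  -- the profile `s J = A'·(1/2)^{J+1}` with lit `perHeight_bound`'s constant
  set A' : ℝ := 72 * max C 0 * (F.L : ℝ) ^ (3 * F.m) * γ⁻¹ ^ A *
    Real.exp ((((3 : ℝ) + A) * Real.log F.L + Real.log 2) ^ 2 / (4 * (cT * b₀ ^ 2 * Real.log F.L ^ 2 / 4))) with hA'
  have hA'0 : 0 ≤ A' := by
    have : (0 : ℝ) ≤ γ⁻¹ := inv_nonneg.mpr hγ.le
    positivity
  obtain ⟨J₀, hJ₀⟩ := geometricProfile_eventually_le_half A'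
  refine ⟨J₀, fun J => A' * ((1 : ℝ) / 2) ^ (J + 1), q,
    fun J _ => max C 0 * (F.scheme ℰp γ).β (J + 1) ^ A * Real.exp (-(cT * B10.pFun b₀ p₀ (Real.sqrt (γ * ((F.L : ℝ)⁻¹) ^ (J + 1))) ^ 2)),
    geometricProfile_nonneg hA'0, hJ₀, geometricProfile_superpoly hA'0, fun J _ => ?_, fun J => ?_, hq, fun J _ B hB hBW => hqfloor J B hB hBW,
    fun J p B hB hBW => (hrows J p B hB hBW).trans (mul_le_mul' (ENNReal.ofReal_le_ofReal (hw J)) le_rfl)⟩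
  · exact mul_nonneg (mul_nonneg hC (pow_nonneg (F.scheme_β_nonneg ℰp hγ.le (J + 1)) A)) (Real.exp_nonneg _)
  · rw [Finset.sum_const, Finset.card_univ, nsmul_eq_mul]
    exact levelSum_printed_le_geometric F hγ hγ1 hb₀ hp1 hC A hcT J

/-- ★★★ **TWO REGIMES, FIBREWISE, PRINT'S CURRENCY: ⟨FIBRE-TAIL-PRINTED₁∘ + MOMENT-LIN₁∘ + FLOOR⟩ ⇒ ✓K's ⟨COND-ODDS₁∘⟩.**  Hypothesis (TAILSUP₁∘'s prefix, then; all letters after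
`F, γ`): a splitting radius `δ₀ ≥ 0`, constants `C` (any sign), `A : ℕ`, `c > 0` and a moment slope `cM < δ₀²∕4`; (FLOOR) at EVERY level `J` a floor `q > 0` as in ✓O; and for every
level `J`, fine plaquette `p ∈ T_{J+1}`, for `(dU_{J+1}.map D)`-a.e. datum `V` in the INTERIOR window (`κ_V = condLaw dU_{J+1} D_{J,J+1} V`):
(TAIL) `∫⁻_{θBal_{J+1} ≤ dist1 U(∂p) < δ₀} boltzmann dκ_V ≤ ofReal(C·β_{J+1}^A·e^{−c·pFun b₀ p₀ (g_{J+1})²})·∫⁻ boltzmann dκ_V` — the moderate window-exit fraction in print's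
per-plaquette currency; (MOMENT-LIN) `⨍ β_{J+1}(1 − Re tr U(∂p)) d(κ_V.withDensity e^{−β_{J+1}A_{¬p}}) ≤ cM·β_{J+1}` — a LINEAR first moment of the deleted plaquette's tilted
action (content iff `δ₀² ≤ 8`: the trivial slope is `cM = 2`).  The profile `s J = (A'_mod + A'_far)·(1∕2)^{J+1}`, `J₀` (after `F.m`), `σm`, `M J = cM·β_{J+1}` are produced
here (companion §1), then ✓P `condGoodOddsDepthOneInt_of_fibreTail_farMoment`. [cite: Balaban1985UV3, (2) p.256, (7) p.257, (38)-(40) p.266 and (67)-(71) p.273] -/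
theorem condGoodOddsDepthOneInt_of_fibreTailPrinted_linearMoment_floor
    (h : ∀ (L : ℕ), ∃ c₀ : ℝ, 0 < c₀ ∧ c₀ ≤ 1 ∧ ∀ (c : ℝ), 0 < c → c ≤ c₀ → ∃ pS : ℝ, ∀ (b₀ p₀ : ℝ), 0 < b₀ → pS ≤ p₀ → 0 < p₀ →
      ∃ γ₁ : ℝ, 0 < γ₁ ∧ ∀ (F : T3Family) (γ : ℝ), F.L = L → 0 < γ → γ ≤ γ₁ →
        ∃ (δ₀ C : ℝ) (A : ℕ) (cT cM : ℝ), 0 ≤ δ₀ ∧ 0 < cT ∧ cM < δ₀ ^ 2 / 4 ∧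
          (∀ J : ℕ, ∃ q : ℝ, 0 < q ∧ ∀ (B : Set (GaugeField (F.P J) 0 (Matrix.specialUnitaryGroup (Fin 2) ℂ))), MeasurableSet B →
            B ⊆ {U | PlaqSmall (θBal F.L γ (c * b₀) p₀ J) U} →
            ENNReal.ofReal q * gibbsK F ℰp γ (J + 1) (descendTo F ℰp J (J + 1) (Nat.le_succ J) ⁻¹' B) ≤
              gibbsK F ℰp γ (J + 1) (descendTo F ℰp J (J + 1) (Nat.le_succ J) ⁻¹' B ∩ histGood F ℰp (θBal F.L γ b₀ p₀) (J + 1) J)) ∧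
          (∀ (J : ℕ) (p : Plaq (F.P (J + 1)) 0),
            ∀ᵐ V ∂((fieldMeasure (F.P (J + 1)) 0 (Matrix.specialUnitaryGroup (Fin 2) ℂ)).map (descendTo F ℰp J (J + 1) (Nat.le_succ J))),
              PlaqSmall (θBal F.L γ (c * b₀) p₀ J) V →
                ∫⁻ U in {U | θBal F.L γ b₀ p₀ (J + 1) ≤ dist1 (GaugeField.plaqHol U p) ∧ dist1 (GaugeField.plaqHol U p) < δ₀},
                    ENNReal.ofReal (boltzmann (F.P (J + 1)) ((F.scheme ℰp γ).β (J + 1)) U)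
                    ∂(condLaw (fieldMeasure (F.P (J + 1)) 0 (Matrix.specialUnitaryGroup (Fin 2) ℂ)) (descendTo F ℰp J (J + 1) (Nat.le_succ J)) V) ≤
                  ENNReal.ofReal (C * (F.scheme ℰp γ).β (J + 1) ^ A *
                      Real.exp (-(cT * B10.pFun b₀ p₀ (Real.sqrt (γ * ((F.L : ℝ)⁻¹) ^ (J + 1))) ^ 2))) *
                    ∫⁻ U, ENNReal.ofReal (boltzmann (F.P (J + 1)) ((F.scheme ℰp γ).β (J + 1)) U)
                      ∂(condLaw (fieldMeasure (F.P (J + 1)) 0 (Matrix.specialUnitaryGroup (Fin 2) ℂ)) (descendTo F ℰp J (J + 1) (Nat.le_succ J)) V)) ∧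
          (∀ (J : ℕ) (p : Plaq (F.P (J + 1)) 0),
            ∀ᵐ V ∂((fieldMeasure (F.P (J + 1)) 0 (Matrix.specialUnitaryGroup (Fin 2) ℂ)).map (descendTo F ℰp J (J + 1) (Nat.le_succ J))),
              PlaqSmall (θBal F.L γ (c * b₀) p₀ J) V →
                ⨍ U, (F.scheme ℰp γ).β (J + 1) * (1 - reTr (GaugeField.plaqHol U p))
                  ∂((condLaw (fieldMeasure (F.P (J + 1)) 0 (Matrix.specialUnitaryGroup (Fin 2) ℂ)) (descendTo F ℰp J (J + 1) (Nat.le_succ J)) V).withDensity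
                    fun U => ENNReal.ofReal (Real.exp (-((F.scheme ℰp γ).β (J + 1) *
                      (wilsonAction4 U - (1 - reTr (GaugeField.plaqHol U p))))))) ≤ cM * (F.scheme ℰp γ).β (J + 1))) :
    ∀ (L : ℕ), ∃ c₀ : ℝ, 0 < c₀ ∧ c₀ ≤ 1 ∧ ∀ (c : ℝ), 0 < c → c ≤ c₀ → ∃ pS : ℝ, ∀ (b₀ p₀ : ℝ), 0 < b₀ → pS ≤ p₀ → 0 < p₀ →
      ∃ γ₁ : ℝ, 0 < γ₁ ∧ ∀ (F : T3Family) (γ : ℝ), F.L = L → 0 < γ → γ ≤ γ₁ →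
        ∃ τ : ℕ → ℝ, (∀ J, 0 ≤ τ J) ∧ (∀ a : ℕ, Tendsto (fun J : ℕ => ((J : ℝ) + 1) ^ a * τ J) atTop (𝓝 0)) ∧
          ∀ (J : ℕ) (B : Set (GaugeField (F.P J) 0 (Matrix.specialUnitaryGroup (Fin 2) ℂ))), MeasurableSet B →
            B ⊆ {U | PlaqSmall (θBal F.L γ (c * b₀) p₀ J) U} →
            gibbsK F ℰp γ (J + 1) (descendTo F ℰp J (J + 1) (Nat.le_succ J) ⁻¹' B) ≤
              ENNReal.ofReal (Real.exp (τ J)) *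
                gibbsK F ℰp γ (J + 1) (descendTo F ℰp J (J + 1) (Nat.le_succ J) ⁻¹' B ∩ histGood F ℰp (θBal F.L γ b₀ p₀) (J + 1) J) := by
  refine condGoodOddsDepthOneInt_of_fibreTail_farMoment fun L => ?_
  obtain ⟨c₀, hc₀, hc₀1, hc⟩ := h L
  refine ⟨c₀, hc₀, hc₀1, fun c hcpos hcle => ?_⟩
  obtain ⟨pS, hpS⟩ := hc c hcpos hcle
  refine ⟨max pS 1, fun b₀ p₀ hb₀ hpS' hp₀ => ?_⟩
  have hp1 : 1 ≤ p₀ := le_trans (le_max_right pS 1) hpS'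
  obtain ⟨γ₁, hγ₁, hγ₁F⟩ := hpS b₀ p₀ hb₀ (le_trans (le_max_left pS 1) hpS') hp₀
  refine ⟨min γ₁ 1, lt_min hγ₁ one_pos, fun F γ hFL hγ hγle => ?_⟩
  have hγ1 : γ ≤ 1 := le_trans hγle (min_le_right γ₁ 1)
  obtain ⟨δ₀, C, A, cT, cM, hδ₀, hcT, hκ, hfloor, htail, hmom⟩ := hγ₁F F γ hFL hγ (le_trans hγle (min_le_left γ₁ 1))
  choose q hq hqfloor using hfloor
  -- a non-negative prefactor `max C 0` (the fibre tails with `C` imply the fibre tails with `max C 0`)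
  have hC : 0 ≤ max C 0 := le_max_right C 0
  have hw : ∀ J : ℕ, C * (F.scheme ℰp γ).β (J + 1) ^ A * Real.exp (-(cT * B10.pFun b₀ p₀ (Real.sqrt (γ * ((F.L : ℝ)⁻¹) ^ (J + 1))) ^ 2)) ≤
      max C 0 * (F.scheme ℰp γ).β (J + 1) ^ A * Real.exp (-(cT * B10.pFun b₀ p₀ (Real.sqrt (γ * ((F.L : ℝ)⁻¹) ^ (J + 1))) ^ 2)) := fun J =>
    mul_le_mul_of_nonneg_right (mul_le_mul_of_nonneg_right (le_max_left C 0) (pow_nonneg (F.scheme_β_nonneg ℰp hγ.le (J + 1)) A))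
      (Real.exp_nonneg _)
  -- the profile `s J = (A'_mod + A'_far)·(1/2)^{J+1}`
  obtain ⟨A', hA'⟩ : ∃ A' : ℝ, A' = 72 * max C 0 * (F.L : ℝ) ^ (3 * F.m) * γ⁻¹ ^ A *
      Real.exp ((((3 : ℝ) + A) * Real.log F.L + Real.log 2) ^ 2 / (4 * (cT * b₀ ^ 2 * Real.log F.L ^ 2 / 4))) +
    72 * 24 * (F.L : ℝ) ^ (3 * F.m) * γ ^ 4 / (δ₀ ^ 2 / 4 - cM) ^ 4 := ⟨_, rfl⟩
  have hA'0 : 0 ≤ A' := by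
    have : (0 : ℝ) ≤ γ⁻¹ := inv_nonneg.mpr hγ.le
    have : (0 : ℝ) < δ₀ ^ 2 / 4 - cM := sub_pos.mpr hκ
    rw [hA']
    positivity
  obtain ⟨J₀, hJ₀⟩ := geometricProfile_eventually_le_half A'
  refine ⟨δ₀, J₀, fun J => A' * ((1 : ℝ) / 2) ^ (J + 1), q,
    fun J _ => max C 0 * (F.scheme ℰp γ).β (J + 1) ^ A * Real.exp (-(cT * B10.pFun b₀ p₀ (Real.sqrt (γ * ((F.L : ℝ)⁻¹) ^ (J + 1))) ^ 2)),
    fun J => cM * (F.scheme ℰp γ).β (J + 1), hδ₀, geometricProfile_nonneg hA'0, hJ₀, geometricProfile_superpoly hA'0, fun J _ => ?_, fun J => ?_, hq,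
    fun J _ B hB hBW => hqfloor J B hB hBW,
    fun J p => (htail J p).mono fun V hV hVW => (hV hVW).trans (mul_le_mul' (ENNReal.ofReal_le_ofReal (hw J)) le_rfl), hmom⟩
  · exact mul_nonneg (mul_nonneg hC (pow_nonneg (F.scheme_β_nonneg ℰp hγ.le (J + 1)) A)) (Real.exp_nonneg _)
  · dsimp only
    rw [Finset.sum_const, Finset.card_univ, nsmul_eq_mul, hA', add_mul]
    exact add_le_add (levelSum_printed_le_geometric F hγ hγ1 hb₀ hp1 hC A hcT J) (farLevelSum_le_geometric F hγ hκ J)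

/-- ★★★ **⟨PINNED-PRINTED₁∘ + FLOOR⟩ ⇒ TAILSUP₁∘** (LINE g21-2 v1.4's interior row `RunPairOrgan.OneLoop.WindowOddsSupDepthOneIntCan`, text verbatim): the one-regime printed door,
then ✓K.  HONEST SCOPE: the printed per-plaquette rows and the floor are the HYPOTHESIS; nothing upstream is proved. [cite: Balaban1985UV3, (2) p.256, (7) p.257, (38)-(40) p.266 and (71) p.273] -/
theorem windowOddsSupDepthOneInt_of_pinnedPrinted_floor
    (h : ∀ (L : ℕ), ∃ c₀ : ℝ, 0 < c₀ ∧ c₀ ≤ 1 ∧ ∀ (c : ℝ), 0 < c → c ≤ c₀ → ∃ pS : ℝ, ∀ (b₀ p₀ : ℝ), 0 < b₀ → pS ≤ p₀ → 0 < p₀ →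
      ∃ γ₁ : ℝ, 0 < γ₁ ∧ ∀ (F : T3Family) (γ : ℝ), F.L = L → 0 < γ → γ ≤ γ₁ →
        ∃ (C : ℝ) (A : ℕ) (cT : ℝ), 0 < cT ∧
          (∀ J : ℕ, ∃ q : ℝ, 0 < q ∧ ∀ (B : Set (GaugeField (F.P J) 0 (Matrix.specialUnitaryGroup (Fin 2) ℂ))), MeasurableSet B →
            B ⊆ {U | PlaqSmall (θBal F.L γ (c * b₀) p₀ J) U} →
            ENNReal.ofReal q * gibbsK F ℰp γ (J + 1) (descendTo F ℰp J (J + 1) (Nat.le_succ J) ⁻¹' B) ≤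
              gibbsK F ℰp γ (J + 1) (descendTo F ℰp J (J + 1) (Nat.le_succ J) ⁻¹' B ∩ histGood F ℰp (θBal F.L γ b₀ p₀) (J + 1) J)) ∧
          ∀ (J : ℕ) (p : Plaq (F.P (J + 1)) 0) (B : Set (GaugeField (F.P J) 0 (Matrix.specialUnitaryGroup (Fin 2) ℂ))), MeasurableSet B →
            B ⊆ {U | PlaqSmall (θBal F.L γ (c * b₀) p₀ J) U} →
            gibbsK F ℰp γ (J + 1) (descendTo F ℰp J (J + 1) (Nat.le_succ J) ⁻¹' B ∩
                {U | θBal F.L γ b₀ p₀ (J + 1) ≤ dist1 (GaugeField.plaqHol U p)}) ≤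
              ENNReal.ofReal (C * (F.scheme ℰp γ).β (J + 1) ^ A *
                  Real.exp (-(cT * B10.pFun b₀ p₀ (Real.sqrt (γ * ((F.L : ℝ)⁻¹) ^ (J + 1))) ^ 2))) *
                gibbsK F ℰp γ (J + 1) (descendTo F ℰp J (J + 1) (Nat.le_succ J) ⁻¹' B)) :
    ∀ (L : ℕ), ∃ c₀ : ℝ, 0 < c₀ ∧ c₀ ≤ 1 ∧ ∀ (c : ℝ), 0 < c → c ≤ c₀ → ∃ pS : ℝ, ∀ (b₀ p₀ : ℝ), 0 < b₀ → pS ≤ p₀ → 0 < p₀ →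
    ∃ γ₁ : ℝ, 0 < γ₁ ∧ ∀ (F : T3Family) (γ : ℝ), F.L = L → 0 < γ → γ ≤ γ₁ →
      ∃ τ : ℕ → ℝ, (∀ J, 0 ≤ τ J) ∧ (∀ a : ℕ, Tendsto (fun J : ℕ => ((J : ℝ) + 1) ^ a * τ J) atTop (𝓝 0)) ∧
        ∀ (ν : ℕ → (j : ℕ) → Measure (GaugeField (F.P j) 0 (Matrix.specialUnitaryGroup (Fin 2) ℂ))),
          (∀ K, ν K K = T4GenFunBounds.gibbsMeasure (F.P K) ((F.scheme ℰp γ).β K)) →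
          (∀ K j, j < K → ν K j = Measure.map (descend F ℰp j) (ν K (j + 1))) →
          ∀ (J : ℕ) (ρ : GaugeField (F.P J) 0 (Matrix.specialUnitaryGroup (Fin 2) ℂ) → ℝ),
            (∀ U, PlaqSmall (θBal F.L γ (c * b₀) p₀ J) U → 0 < ρ U) →
            ν (J + 1) J = (fieldMeasure _ _ _).withDensity (fun U => ENNReal.ofReal (ρ U)) →
            ContinuousOn ρ {U | PlaqSmall (θBal F.L γ (c * b₀) p₀ J) U} →
            (∀ U : GaugeField (F.P J) 0 (Matrix.specialUnitaryGroup (Fin 2) ℂ), PlaqSmall (θBal F.L γ (c * b₀) p₀ J) U →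
                0 < heightDensityCan F γ (Nat.le_succ J) (histGood F ℰp (θBal F.L γ b₀ p₀) (J + 1) J) U) →
            ∃ a₀ : ℝ, ∀ U : GaugeField (F.P J) 0 (Matrix.specialUnitaryGroup (Fin 2) ℂ), PlaqSmall (θBal F.L γ (c * b₀) p₀ J) U →
              0 ≤ Real.log (ρ U) - a₀ - Real.log (heightDensityCan F γ (Nat.le_succ J) (histGood F ℰp (θBal F.L γ b₀ p₀) (J + 1) J) U) ∧
              Real.log (ρ U) - a₀ - Real.log (heightDensityCan F γ (Nat.le_succ J) (histGood F ℰp (θBal F.L γ b₀ p₀) (J + 1) J) U) ≤ τ J :=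
  FluctuationComparisonRegPrIntLSupTailReductionInt.windowOddsSupDepthOneIntCan_of_condGoodOddsDepthOneInt
    (condGoodOddsDepthOneInt_of_pinnedPrinted_floor h)

/-- ★★★ **⟨FIBRE-TAIL-PRINTED₁∘ + MOMENT-LIN₁∘ + FLOOR⟩ ⇒ TAILSUP₁∘** (LINE g21-2 v1.4's interior row `RunPairOrgan.OneLoop.WindowOddsSupDepthOneIntCan`, text verbatim): the
two-regime fibrewise printed door, then ✓K.  AFTER THIS FILE THE HAND'S RESIDUE FOR TAILSUP₁∘ IS EXACTLY: (TAIL) the per-plaquette moderate window-exit fraction of the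
Boltzmann-tilted conditional Haar law in print's currency `C·β^A·e^{−c·p(g)²}` (chart + convexity one level deep), (MOMENT-LIN) a linear first moment `≤ cM·β` of the deleted
plaquette's tilted action with `cM < δ₀²∕4` (equipartition), and the per-level FLOOR — all bookkeeping letters are discharged.  HONEST SCOPE: those three are the HYPOTHESIS;
nothing upstream is proved. [cite: Balaban1985UV3, (2) p.256, (7) p.257, (38)-(40) p.266 and (67)-(71) p.273] -/
theorem windowOddsSupDepthOneInt_of_fibreTailPrinted_linearMoment_floor
    (h : ∀ (L : ℕ), ∃ c₀ : ℝ, 0 < c₀ ∧ c₀ ≤ 1 ∧ ∀ (c : ℝ), 0 < c → c ≤ c₀ → ∃ pS : ℝ, ∀ (b₀ p₀ : ℝ), 0 < b₀ → pS ≤ p₀ → 0 < p₀ →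
      ∃ γ₁ : ℝ, 0 < γ₁ ∧ ∀ (F : T3Family) (γ : ℝ), F.L = L → 0 < γ → γ ≤ γ₁ →
        ∃ (δ₀ C : ℝ) (A : ℕ) (cT cM : ℝ), 0 ≤ δ₀ ∧ 0 < cT ∧ cM < δ₀ ^ 2 / 4 ∧
          (∀ J : ℕ, ∃ q : ℝ, 0 < q ∧ ∀ (B : Set (GaugeField (F.P J) 0 (Matrix.specialUnitaryGroup (Fin 2) ℂ))), MeasurableSet B →
            B ⊆ {U | PlaqSmall (θBal F.L γ (c * b₀) p₀ J) U} →
            ENNReal.ofReal q * gibbsK F ℰp γ (J + 1) (descendTo F ℰp J (J + 1) (Nat.le_succ J) ⁻¹' B) ≤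
              gibbsK F ℰp γ (J + 1) (descendTo F ℰp J (J + 1) (Nat.le_succ J) ⁻¹' B ∩ histGood F ℰp (θBal F.L γ b₀ p₀) (J + 1) J)) ∧
          (∀ (J : ℕ) (p : Plaq (F.P (J + 1)) 0),
            ∀ᵐ V ∂((fieldMeasure (F.P (J + 1)) 0 (Matrix.specialUnitaryGroup (Fin 2) ℂ)).map (descendTo F ℰp J (J + 1) (Nat.le_succ J))),
              PlaqSmall (θBal F.L γ (c * b₀) p₀ J) V →
                ∫⁻ U in {U | θBal F.L γ b₀ p₀ (J + 1) ≤ dist1 (GaugeField.plaqHol U p) ∧ dist1 (GaugeField.plaqHol U p) < δ₀},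
                    ENNReal.ofReal (boltzmann (F.P (J + 1)) ((F.scheme ℰp γ).β (J + 1)) U)
                    ∂(condLaw (fieldMeasure (F.P (J + 1)) 0 (Matrix.specialUnitaryGroup (Fin 2) ℂ)) (descendTo F ℰp J (J + 1) (Nat.le_succ J)) V) ≤
                  ENNReal.ofReal (C * (F.scheme ℰp γ).β (J + 1) ^ A *
                      Real.exp (-(cT * B10.pFun b₀ p₀ (Real.sqrt (γ * ((F.L : ℝ)⁻¹) ^ (J + 1))) ^ 2))) *
                    ∫⁻ U, ENNReal.ofReal (boltzmann (F.P (J + 1)) ((F.scheme ℰp γ).β (J + 1)) U)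
                      ∂(condLaw (fieldMeasure (F.P (J + 1)) 0 (Matrix.specialUnitaryGroup (Fin 2) ℂ)) (descendTo F ℰp J (J + 1) (Nat.le_succ J)) V)) ∧
          (∀ (J : ℕ) (p : Plaq (F.P (J + 1)) 0),
            ∀ᵐ V ∂((fieldMeasure (F.P (J + 1)) 0 (Matrix.specialUnitaryGroup (Fin 2) ℂ)).map (descendTo F ℰp J (J + 1) (Nat.le_succ J))),
              PlaqSmall (θBal F.L γ (c * b₀) p₀ J) V →
                ⨍ U, (F.scheme ℰp γ).β (J + 1) * (1 - reTr (GaugeField.plaqHol U p))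
                  ∂((condLaw (fieldMeasure (F.P (J + 1)) 0 (Matrix.specialUnitaryGroup (Fin 2) ℂ)) (descendTo F ℰp J (J + 1) (Nat.le_succ J)) V).withDensity
                    fun U => ENNReal.ofReal (Real.exp (-((F.scheme ℰp γ).β (J + 1) *
                      (wilsonAction4 U - (1 - reTr (GaugeField.plaqHol U p))))))) ≤ cM * (F.scheme ℰp γ).β (J + 1))) :
    ∀ (L : ℕ), ∃ c₀ : ℝ, 0 < c₀ ∧ c₀ ≤ 1 ∧ ∀ (c : ℝ), 0 < c → c ≤ c₀ → ∃ pS : ℝ, ∀ (b₀ p₀ : ℝ), 0 < b₀ → pS ≤ p₀ → 0 < p₀ →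
    ∃ γ₁ : ℝ, 0 < γ₁ ∧ ∀ (F : T3Family) (γ : ℝ), F.L = L → 0 < γ → γ ≤ γ₁ →
      ∃ τ : ℕ → ℝ, (∀ J, 0 ≤ τ J) ∧ (∀ a : ℕ, Tendsto (fun J : ℕ => ((J : ℝ) + 1) ^ a * τ J) atTop (𝓝 0)) ∧
        ∀ (ν : ℕ → (j : ℕ) → Measure (GaugeField (F.P j) 0 (Matrix.specialUnitaryGroup (Fin 2) ℂ))),
          (∀ K, ν K K = T4GenFunBounds.gibbsMeasure (F.P K) ((F.scheme ℰp γ).β K)) →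
          (∀ K j, j < K → ν K j = Measure.map (descend F ℰp j) (ν K (j + 1))) →
          ∀ (J : ℕ) (ρ : GaugeField (F.P J) 0 (Matrix.specialUnitaryGroup (Fin 2) ℂ) → ℝ),
            (∀ U, PlaqSmall (θBal F.L γ (c * b₀) p₀ J) U → 0 < ρ U) →
            ν (J + 1) J = (fieldMeasure _ _ _).withDensity (fun U => ENNReal.ofReal (ρ U)) →
            ContinuousOn ρ {U | PlaqSmall (θBal F.L γ (c * b₀) p₀ J) U} →
            (∀ U : GaugeField (F.P J) 0 (Matrix.specialUnitaryGroup (Fin 2) ℂ), PlaqSmall (θBal F.L γ (c * b₀) p₀ J) U →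
                0 < heightDensityCan F γ (Nat.le_succ J) (histGood F ℰp (θBal F.L γ b₀ p₀) (J + 1) J) U) →
            ∃ a₀ : ℝ, ∀ U : GaugeField (F.P J) 0 (Matrix.specialUnitaryGroup (Fin 2) ℂ), PlaqSmall (θBal F.L γ (c * b₀) p₀ J) U →
              0 ≤ Real.log (ρ U) - a₀ - Real.log (heightDensityCan F γ (Nat.le_succ J) (histGood F ℰp (θBal F.L γ b₀ p₀) (J + 1) J) U) ∧
              Real.log (ρ U) - a₀ - Real.log (heightDensityCan F γ (Nat.le_succ J) (histGood F ℰp (θBal F.L γ b₀ p₀) (J + 1) J) U) ≤ τ J :=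
  FluctuationComparisonRegPrIntLSupTailReductionInt.windowOddsSupDepthOneIntCan_of_condGoodOddsDepthOneInt
    (condGoodOddsDepthOneInt_of_fibreTailPrinted_linearMoment_floor h)

end Printed

end Summit.QuantumFields.YangMills.Theorems.FluctuationComparisonRegPrIntLSupTailCoverUnionPrintedForm

end
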